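import Literature.MathematicalPhysics.QuantumManyBody.PeriodicFormDomain
import Mathlib.Analysis.InnerProductSpace.Calculus
import Mathlib.Analysis.SpecialFunctions.Sqrt
import HarnessLib

/-!
# Route BECHusimiAmplitudeGas — `PositivityReduction` (item stmt-AtomisticToContinuum-11998), part 2:
# nonnegative near-minimisers by the regularised modulus

Helper file (`--supports stmt-AtomisticToContinuum-11998`). The hypothesis `PeriodicBECNonneg` of
the item only speaks about periodic near-minimisers that are pointwise NONNEGATIVE reals; to use it
one needs such states at every energy slack `δ > 0`. They are produced here from an arbitrary
periodic `C¹` Bose trial state `Ψ` by the **regularised modulus**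
`Φ = Z⁻¹ √(|Ψ|² + η²)`, `Z² = 1 + η² L^{3N}` (`exists_regularisedModulus`): `Φ` is again `C¹`
(no loss of differentiability at the zeros of `Ψ`, unlike `|Ψ|`), periodic, symmetric, normalised
on the cell, nonnegative, and

* `|∇Φ|² ≤ |∇Ψ|²` pointwise (the diamagnetic inequality in its smooth form:
  `|∂ √(|Ψ|²+η²)| = |Re(Ψ̄ ∂Ψ)| / √(|Ψ|²+η²) ≤ |∂Ψ|`, and `Z ≥ 1`;
  `kineticDensity_regularisedModulus_le`),
* `W Φ² = W (|Ψ|² + η²)/Z² ≤ W|Ψ|² + η² W`,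

so `periodicEnergy v Φ ≤ periodicEnergy v Ψ + η² ∫_cell W` for every measurable `v`
(`W = ∑_{i<j} v^per(xᵢ - xⱼ)`). When `W ∈ L¹(cell)` (bounded `v`) and `η → 0` this gives nonnegative
`δ`-near-minimisers for every `δ > 0` (`exists_nonneg_nearMinimiser`, part 3).
-/

noncomputable section

open MeasureTheory Filter Set Complex
open scoped ENNReal NNReal Topology ComplexConjugate InnerProductSpace RealInnerProductSpace

namespace Summit.AtomisticToContinuum.BoseEinsteinCondensation.Theorems

open Literature.MathematicalPhysics.QuantumManyBody.BoseGas Literature.MathematicalPhysics.QuantumManyBody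

variable {N : ℕ} {L : ℝ}

/-- The periodic interaction `W = ∑_{i<j} v^per(xᵢ - xⱼ)` is measurable (private copy of the tree
lemma, to keep the imports small). [folklore] -/
private theorem measurable_periodicInteraction_rm {v : ℝ → ℝ≥0∞} (hv : Measurable v) (L : ℝ) :
    Measurable (periodicInteraction (N := N) v L) := by
  unfold periodicInteraction periodizedPotential
  refine Finset.measurable_sum _ fun i _ => Finset.measurable_sum _ fun j _ => ?_
  exact (Measurable.tsum fun n => hv.comp (measurable_id.sub_const _).norm).comp
    ((measurable_pi_apply i).sub (measurable_pi_apply j))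

/-- `‖(r : ℂ)‖₊² = ofReal (r²)` in `ℝ≥0∞` (private copy). [folklore] -/
private theorem ennnorm_sq_ofReal_rm (r : ℝ) : ((‖(r : ℂ)‖₊ : ℝ≥0∞)) ^ 2 = ENNReal.ofReal (r ^ 2) := by
  rw [coe_nnnorm_sq_eq_ofReal, Complex.norm_real, Real.norm_eq_abs, sq_abs]

/-! ### The derivative of the regularised modulus -/

/-- **Smooth diamagnetic inequality.** For a differentiable `Ψ : (ℝ³)^N → ℂ`, `η > 0` and
`0 ≤ c ≤ 1`, the real `C¹` function `c √(|Ψ|² + η²)` (read in `ℂ`) has directional derivatives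
dominated by those of `Ψ`: `|∂_h (c√(|Ψ|²+η²))| = c |Re⟨Ψ, ∂_hΨ⟩| / √(|Ψ|²+η²) ≤ |∂_h Ψ|`.
[folklore] -/
theorem norm_fderiv_regularisedModulus_apply_le {Ψ : Config N → ℂ} (hΨ : Differentiable ℝ Ψ)
    {η : ℝ} (hη : 0 < η) {c : ℝ} (hc0 : 0 ≤ c) (hc1 : c ≤ 1) (X h : Config N) :
    ‖fderiv ℝ (fun Y => ((c * Real.sqrt (‖Ψ Y‖ ^ 2 + η ^ 2) : ℝ) : ℂ)) X h‖ ≤ ‖fderiv ℝ Ψ X h‖ := by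
  set s : ℝ := Real.sqrt (‖Ψ X‖ ^ 2 + η ^ 2) with hs
  have hpos : 0 < ‖Ψ X‖ ^ 2 + η ^ 2 := by positivity
  have hs0 : 0 < s := Real.sqrt_pos.2 hpos
  have hΨs : ‖Ψ X‖ ≤ s := by
    rw [hs, Real.le_sqrt (norm_nonneg _) hpos.le]
    nlinarith [sq_nonneg η]
  have h1 := ((hΨ X).hasFDerivAt.norm_sq).add_const (η ^ 2)
  have h2 := h1.sqrt hpos.ne'
  have h3 := h2.const_mul c
  have h4 : HasFDerivAt (fun Y => ((c * Real.sqrt (‖Ψ Y‖ ^ 2 + η ^ 2) : ℝ) : ℂ)) _ X :=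
    Complex.ofRealCLM.hasFDerivAt.comp X h3
  rw [h4.fderiv]
  simp only [ContinuousLinearMap.comp_apply, _root_.smul_apply, two_smul, _root_.add_apply,
    innerSL_apply_apply, Complex.ofRealCLM_apply, smul_eq_mul, Complex.norm_real, Real.norm_eq_abs]
  set I : ℝ := ⟪Ψ X, fderiv ℝ Ψ X h⟫_ℝ with hI
  have hIle : |I| ≤ ‖Ψ X‖ * ‖fderiv ℝ Ψ X h‖ := abs_real_inner_le_norm _ _
  have heq : c * (1 / (2 * s) * (I + I)) = c * I / s := by
    field_simp
    ring
  rw [← hs, heq, abs_div, abs_mul, abs_of_nonneg hc0, abs_of_pos hs0, div_le_iff₀ hs0]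
  calc c * |I| ≤ 1 * (‖Ψ X‖ * ‖fderiv ℝ Ψ X h‖) := mul_le_mul hc1 hIle (abs_nonneg _) zero_le_one
    _ = ‖fderiv ℝ Ψ X h‖ * ‖Ψ X‖ := by ring
    _ ≤ ‖fderiv ℝ Ψ X h‖ * s := mul_le_mul_of_nonneg_left hΨs (norm_nonneg _)

/-- **The regularised modulus does not increase the kinetic density**:
`|∇(c√(|Ψ|²+η²))|² ≤ |∇Ψ|²` pointwise, for `0 ≤ c ≤ 1`. [folklore] -/
theorem kineticDensity_regularisedModulus_le {Ψ : Config N → ℂ} (hΨ : Differentiable ℝ Ψ)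
    {η : ℝ} (hη : 0 < η) {c : ℝ} (hc0 : 0 ≤ c) (hc1 : c ≤ 1) (X : Config N) :
    kineticDensity (fun Y => ((c * Real.sqrt (‖Ψ Y‖ ^ 2 + η ^ 2) : ℝ) : ℂ)) X ≤ kineticDensity Ψ X := by
  unfold kineticDensity
  refine Finset.sum_le_sum fun i _ => Finset.sum_le_sum fun k _ => ?_
  have h := norm_fderiv_regularisedModulus_apply_le hΨ hη hc0 hc1 X
    (Pi.single i (EuclideanSpace.single k (1 : ℝ)))
  gcongr
  rw [← NNReal.coe_le_coe, coe_nnnorm, coe_nnnorm]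
  exact h

/-! ### The regularised modulus as a periodic trial state -/

/-- **The regularised modulus of a periodic trial state.** For `L > 0`, a periodic `C¹` Bose trial
state `Ψ` on the torus of side `L` and `η > 0`, the function `Φ = Z⁻¹√(|Ψ|² + η²)` with
`Z = √(1 + η² L^{3N})` is a periodic `C¹` Bose trial state (normalised on the cell), pointwise a
nonnegative real, and for every measurable pair potential `v`:
`periodicEnergy v Φ ≤ periodicEnergy v Ψ + η² ∫_{cell} ∑_{i<j} v^per(xᵢ - xⱼ)` (diamagnetic
inequality for the kinetic term, `Z ≥ 1`, and `Φ² = (|Ψ|² + η²)/Z² ≤ |Ψ|² + η²` for the potential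
term). [folklore] -/
theorem exists_regularisedModulus (hL : 0 < L) (Ψ : PeriodicTrialState N L) {η : ℝ} (hη : 0 < η) :
    ∃ Φ : PeriodicTrialState N L,
      (∀ X, Φ.ψ X = (((Real.sqrt (1 + η ^ 2 * (L ^ 3) ^ N))⁻¹ *
        Real.sqrt (‖Ψ.ψ X‖ ^ 2 + η ^ 2) : ℝ) : ℂ)) ∧
      (∀ X, Φ.ψ X = ((‖Φ.ψ X‖ : ℝ) : ℂ)) ∧
      ∀ v : ℝ → ℝ≥0∞, Measurable v →
        periodicEnergy v Φ ≤ periodicEnergy v Ψ +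
          ENNReal.ofReal (η ^ 2) * ∫⁻ X in cellN N L, periodicInteraction v L X := by
  set V : ℝ := (L ^ 3) ^ N with hV
  have hV0 : 0 < V := by positivity
  set Z : ℝ := Real.sqrt (1 + η ^ 2 * V) with hZ
  have hZ2 : Z ^ 2 = 1 + η ^ 2 * V := Real.sq_sqrt (by positivity)
  have hZ1 : 1 ≤ Z := by
    rw [hZ, Real.one_le_sqrt]
    nlinarith [sq_nonneg η]
  have hZ0 : 0 < Z := by positivity
  set c : ℝ := Z⁻¹ with hc
  have hc0 : 0 ≤ c := by positivity
  have hc1 : c ≤ 1 := inv_le_one_of_one_le₀ hZ1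
  have hcZ : c ^ 2 * (1 + η ^ 2 * V) = 1 := by
    rw [← hZ2, hc, inv_pow, inv_mul_cancel₀ (by positivity)]
  -- the function
  obtain ⟨g, hg⟩ : ∃ g : Config N → ℝ, g = fun X => c * Real.sqrt (‖Ψ.ψ X‖ ^ 2 + η ^ 2) := ⟨_, rfl⟩
  have hg0 : ∀ X, 0 ≤ g X := fun X => by rw [hg]; exact mul_nonneg hc0 (Real.sqrt_nonneg _)
  have hfC : ContDiff ℝ 1 fun X => ‖Ψ.ψ X‖ ^ 2 + η ^ 2 := (Ψ.contDiff.norm_sq ℂ).add contDiff_const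
  have hgC : ContDiff ℝ 1 g := by
    rw [hg]
    exact contDiff_const.mul (hfC.sqrt fun X => by positivity)
  have hmeasΨ : Measurable fun X => ((‖Ψ.ψ X‖₊ : ℝ≥0∞)) ^ 2 :=
    (Ψ.contDiff.continuous.measurable.nnnorm.coe_nnreal_ennreal).pow_const 2
  -- the pointwise square
  have hpt : ∀ X, ((‖((g X : ℝ) : ℂ)‖₊ : ℝ≥0∞)) ^ 2 =
      ENNReal.ofReal (c ^ 2) * (((‖Ψ.ψ X‖₊ : ℝ≥0∞)) ^ 2 + ENNReal.ofReal (η ^ 2)) := by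
    intro X
    rw [ennnorm_sq_ofReal_rm, hg]
    simp only
    rw [mul_pow, Real.sq_sqrt (by positivity), ENNReal.ofReal_mul (sq_nonneg c),
      ENNReal.ofReal_add (by positivity) (by positivity), coe_nnnorm_sq_eq_ofReal]
  -- the trial state
  let Φ : PeriodicTrialState N L :=
    { ψ := fun X => ((g X : ℝ) : ℂ)
      contDiff := Complex.ofRealCLM.contDiff.comp hgC
      periodic := fun X i k => by simp only [hg, Ψ.periodic]
      symm := fun σ X => by simp only [hg, Ψ.symm]
      norm_eq := by
        simp_rw [hpt]
        rw [lintegral_const_mul (ENNReal.ofReal (c ^ 2))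
            (show Measurable fun X => ((‖Ψ.ψ X‖₊ : ℝ≥0∞)) ^ 2 + ENNReal.ofReal (η ^ 2) from
              hmeasΨ.add measurable_const),
          lintegral_add_right _ measurable_const,
          setLIntegral_const, volume_cellN, Ψ.norm_eq, ← ENNReal.ofReal_pow hL.le,
          ← ENNReal.ofReal_pow (by positivity), ← ENNReal.ofReal_mul (sq_nonneg η), ← hV,
          ← ENNReal.ofReal_one, ← ENNReal.ofReal_add zero_le_one (by positivity),
          ← ENNReal.ofReal_mul (sq_nonneg c), hcZ] }
  refine ⟨Φ, fun X => by simp only [Φ, hg], fun X => ?_, fun v hv => ?_⟩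
  · show ((g X : ℝ) : ℂ) = ((‖((g X : ℝ) : ℂ)‖ : ℝ) : ℂ)
    rw [Complex.norm_real, Real.norm_of_nonneg (hg0 X)]
  · -- the energy bound
    have hW := measurable_periodicInteraction_rm (N := N) hv L
    have hkin : ∀ X, kineticDensity (fun Y => ((g Y : ℝ) : ℂ)) X ≤ kineticDensity Ψ.ψ X := by
      intro X
      rw [hg]
      exact kineticDensity_regularisedModulus_le (Ψ.contDiff.differentiable one_ne_zero) hη hc0 hc1 X
    have hc2 : ENNReal.ofReal (c ^ 2) ≤ 1 := by
      rw [← ENNReal.ofReal_one]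
      exact ENNReal.ofReal_le_ofReal (by nlinarith)
    have hpot : ∀ X, periodicInteraction v L X * ((‖((g X : ℝ) : ℂ)‖₊ : ℝ≥0∞)) ^ 2 ≤
        periodicInteraction v L X * ((‖Ψ.ψ X‖₊ : ℝ≥0∞)) ^ 2 +
          ENNReal.ofReal (η ^ 2) * periodicInteraction v L X := by
      intro X
      rw [hpt X]
      calc periodicInteraction v L X *
            (ENNReal.ofReal (c ^ 2) * (((‖Ψ.ψ X‖₊ : ℝ≥0∞)) ^ 2 + ENNReal.ofReal (η ^ 2)))
          ≤ periodicInteraction v L X * (1 * (((‖Ψ.ψ X‖₊ : ℝ≥0∞)) ^ 2 + ENNReal.ofReal (η ^ 2))) := by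
            gcongr
        _ = periodicInteraction v L X * ((‖Ψ.ψ X‖₊ : ℝ≥0∞)) ^ 2 +
            ENNReal.ofReal (η ^ 2) * periodicInteraction v L X := by ring
    calc periodicEnergy v Φ
        = ∫⁻ X in cellN N L, kineticDensity (fun Y => ((g Y : ℝ) : ℂ)) X +
            periodicInteraction v L X * ((‖((g X : ℝ) : ℂ)‖₊ : ℝ≥0∞)) ^ 2 := rfl
      _ ≤ ∫⁻ X in cellN N L, (kineticDensity Ψ.ψ X +
            periodicInteraction v L X * ((‖Ψ.ψ X‖₊ : ℝ≥0∞)) ^ 2) +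
            ENNReal.ofReal (η ^ 2) * periodicInteraction v L X := by
          refine lintegral_mono fun X => ?_
          rw [add_assoc]
          exact add_le_add (hkin X) (hpot X)
      _ = periodicEnergy v Ψ + ENNReal.ofReal (η ^ 2) * ∫⁻ X in cellN N L, periodicInteraction v L X := by
          rw [lintegral_add_right _ (hW.const_mul _), lintegral_const_mul _ hW]
          rfl

end Summit.AtomisticToContinuum.BoseEinsteinCondensation.Theorems

end
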